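import Literature.MathematicalPhysics.QuantumFieldTheory.Balaban1983to89.B4Torus248Decay

/-!
# `Balaban1983to89.B4StripSumsDeriv` — the DERIVATIVE half of B4 Lemma 2.4 (2.35): the `n`-uniform sums of the
# differentiated `l`-sum (2.49) and the `j`-uniform exponential decay of the kernel of `∂^ξ_μ G_j Q_j^*`

T. Bałaban, *Regularity and decay of lattice Green's functions*, Commun. Math. Phys. **89**, 571–597 (1983)
[Balaban1983RegularityDecay] (cell paper B4): p. 573 [PDF 3] (the difference derivative), p. 582 [PDF 12] Lemma 2.4 (2.35),
p. 585 [PDF 15] (2.48)–(2.49), p. 586 [PDF 16] l. 13–15.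

## The printed text (verbatim)

p. 573 [PDF 3]: *"[Of course ∂^η_μ is a difference derivative defined by (∂^η_μA)(x) = η^{−1}(A(x+ηe_μ) − A(x)).]"*

p. 582 [PDF 12], Lemma 2.4:
  (2.35) `|(G_j(□)Q_j^*)(x,y)|, |(∂^{L^{−j}}_μ G_j(□)Q_j^*)(x,y)| ≤ c₀ e^{−δ₀|x−y|}`.

p. 585 [PDF 15], after (2.49): *"where Δ¹(p') = Σ_{μ=1}^{d}|e^{−ip'_μ} − 1|² + m_j², ∂^ξ_μ(p) = (e^{iξp_μ} − 1)/ξ"*; and the bound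
chain
*"It is easy to prove that the underintegral expression is bounded because"*
`O(1)Π_μ|p'_μ|/|p'_μ+l_μ| ≤ |u_j(p'+l)| ≤ O(1)Π_μ|p'_μ|/|p'_μ+l_μ| ≤ O(1)Π_μ(1+|l_μ|)^{−1}`, …, `|∂^ξ_μ(p'+l)| ≤ O(1)|p'_μ+l_μ|`.

p. 586 [PDF 16] l. 13–15: *"Shifting the domain of integration in (2.49) into a complex domain in the direction of the vector
x'−y, we can bound the left hand side of (2.49) by a constant depending on α multiplied by the exponential factor … We get the
inequality (2.36). The inequalities (2.35) are proved in the same way and constants depend on d only."*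

## What this file proves (the audit's proof along the printed method; nothing of B4 is asserted)

`B4StripSums` typed the regrouped `l`-sum `G_{n,a,m²,τ}(p′) = Σ_k F_{n,τ}(k;p′) R_k(p′)/E(p′)` of (2.48) (`n = L^j = ξ⁻¹`,
`l = 2πk`) and proved it `StripRegular` uniformly, whence the FIRST quantity of (2.35).  Applying the difference derivative
`∂^ξ_μ` in `x` to (2.48) multiplies the `l`-th term by the printed symbol `∂^ξ_μ(p′+l) = (e^{iξ(p′_μ+l_μ)} − 1)/ξ`
(as displayed in (2.49)), i.e. by `D_n(k_μ; p′_μ) = n (e^{i(p′_μ + 2πk_μ)/n} − 1)` (§1).  This symbol GROWS like `|p′_μ + l_μ|`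
(it is `O(n)` on the Brillouin zone of the fine lattice), so it is never bounded alone: §1 proves the exact cancellation
`D_n(j; z) · v_n(j; z) = (1 − e^{−iz}) e^{i(z+2πj)/n}` against the `μ`-th factor `v_n` of the block-averaging symbol `u_j`
(the typed form of the two printed bounds `|∂^ξ_μ(p'+l)| ≤ O(1)|p'_μ+l_μ|`, `|u_j(p'+l)| ≤ O(1)Π_μ|p'_μ|/|p'_μ+l_μ|`), bounded
by `6` on `|Im z| ≤ 1/2`.  The `μ`-th coordinate thereby loses its decay `1/ω_n(k_μ)`; §2 restores summability by splitting
the quadratic gain `1/W_n(k)` of the regrouped ratio `R_k` (`B4StripSums.re_DeltaXi_shift_ge_W`) as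
`1/W ≤ ω_n(k_μ)^{−3/2} · Π_{ν ≠ μ} ω_n(k_ν)^{−1/(2(d+1))}`, so that the `l`-sum is bounded by the `n`-UNIFORM constant
`2ζ(3/2) · (48 ζ(1 + 1/(2(d+1))))^d` (§3; the printed `O(1)(Σ_{l∈Z}(1+|l_μ|)^{−1−(1−α)/d})^d` of (2.51) at `α = 0`, with the
audit's exponents).  §4–§6 repeat the holomorphy / side-periodicity / assembly of `B4StripSums` §4–§6 for the differentiated
multiplier `GD_{n,a,m²,τ,μ} = Σ_k D_n(k_μ; p′_μ) F R_k/E` and conclude, by the generic engine `B4ContourShift.latticeKernel_decay`,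
the SECOND quantity of (2.35) on the infinite lattice (`dkernel248_decay`: for `x = x⁰ + τ/n`, `x⁰, y ∈ ℤ^{d+1}`,
`(∂^ξ_μ G_jQ_j^*)(x, y) = n[(G_jQ_j^*)(x + e_μ/n, y) − (G_jQ_j^*)(x, y)] = latticeKernel GD (x⁰ − y)`), uniformly in
`n = L^j ≥ 1`, `a ∈ [a₋, a₊]`, `m² ∈ [0, m²₊]`, the block offset `τ` and the direction `μ`; §7 is the finite-torus corollary
through `B4TorusKernel` (as `B4Torus248Decay`).  ONLY HYPOTHESIS of the headline theorems: `0 < a₋`.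

NOT covered: the Hölder quotient (2.36) (the extra factor `|x−x′|^{−α}(e^{i(p′+l)·(x−x′)} − 1)` and the `Δ¹`-regrouping of
(2.49)); the operators with boundary conditions (Cor. 2.3, GAPS G-B4-04); the operator identity "kernel of the torus
resolvent = periodisation" (declared, not typed, in `B4Torus248Decay`).

Tags (exact census): 11 `[cite: …]` — on the dictionary definitions/lemma `D`, `termD`, `GD`, `termD_eq_printed`,
`torusKernelD248` (the last also `[folklore]`) and on the six headline theorems: §6 `derivative248_stripRegular`,
`dkernel248_decay`, `dkernel248_decay_euclid` (docstrings say "proof supplied by the audit along the printed method") and §7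
`torusKernelD248_eq_periodise`, `dkernel248_torusKernel_decay_torusMetric`, `dkernel248_periodise_decay` ("proof supplied by
the audit, not printed"); everything else `[folklore]` (35 declarations).

REVISION LOG. v1 = p179357 (commit 29a822a5461b).  v1.1 (this text; DOCSTRING-ONLY, no declaration, statement or proof
touched): the LOW nits G-pv06-7 of the cross-read C-pv06-10 — N1 the tag census above made exact (v1 said "three headline
theorems" and omitted `torusKernelD248` and the §7 theorems); N2 the p. 586 locator of the reference line corrected to
l. 13–15 (the quoted sentences; v1 and the immutable gate cite string of p179357 read "l. 9–15", the whole paragraph); N3 the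
printed `Σ_{μ=1}^{d}` restored inside the verbatim-marked `Δ¹(p')` quotation (v1 compressed it to `Σ_μ`).
-/

namespace Literature.MathematicalPhysics.QuantumFieldTheory.Balaban1983to89.B4StripSumsDeriv

open Complex Finset
open Literature.MathematicalPhysics.QuantumFieldTheory.Balaban1983to89.B4Strip
open Literature.MathematicalPhysics.QuantumFieldTheory.Balaban1983to89.B4StripCauchy
open Literature.MathematicalPhysics.QuantumFieldTheory.Balaban1983to89.B5Strip145Analytic
open Literature.MathematicalPhysics.QuantumFieldTheory.Balaban1983to89.B5Strip145Decay
open Literature.MathematicalPhysics.QuantumFieldTheory.Balaban1983to89.B4ContourShift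
open Literature.MathematicalPhysics.QuantumFieldTheory.Balaban1983to89.B4StripSums
open scoped Real

noncomputable section

variable {d : ℕ}

/-! ### §1 One coordinate: the difference-derivative symbol and its cancellation against `v_n` -/

/-- THE PRINTED DIFFERENCE-DERIVATIVE SYMBOL `∂^ξ_μ(p) = (e^{iξp_μ} − 1)/ξ` at `p_μ = z + 2πj`, `ξ = 1/n`:
`D_n(j; z) = n (e^{i(z + 2πj)/n} − 1)`. [cite: Balaban1983RegularityDecay, (2.49) p.585] -/
def D (n j : ℕ) (z : ℂ) : ℂ := (n : ℂ) * (cexp (I * (z + 2 * π * j) / n) - 1)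

/-- the exponential in `D` is the inverse of `w_n(j; z) = e^{−i(z+2πj)/n}`. [folklore] -/
theorem exp_eq_w_inv (n j : ℕ) (z : ℂ) : cexp (I * (z + 2 * π * j) / n) = (w n j z)⁻¹ := by
  unfold w
  rw [← Complex.exp_neg]
  congr 1
  ring

/-- `D_n(j; z) = n (w_n(j; z)⁻¹ − 1)`. [folklore] -/
theorem D_eq (n j : ℕ) (z : ℂ) : D n j z = (n : ℂ) * ((w n j z)⁻¹ - 1) := by
  unfold D
  rw [exp_eq_w_inv]

/-- `e^{i(z+2πj)/n} · w_n(j; z) = 1`. [folklore] -/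
theorem exp_mul_w (n j : ℕ) (z : ℂ) : cexp (I * (z + 2 * π * j) / n) * w n j z = 1 := by
  unfold w
  rw [← Complex.exp_add]
  convert Complex.exp_zero using 2
  ring

/-- **THE CANCELLATION** (typed form of the printed pair of bounds `|∂^ξ_μ(p'+l)| ≤ O(1)|p'_μ+l_μ|`,
`|u_j(p'+l)| ≤ O(1)Π_μ|p'_μ|/|p'_μ+l_μ|` in the `μ`-th coordinate, as an exact identity):
`D_n(j; z) · v_n(j; z) = (1 − e^{−iz}) · e^{i(z+2πj)/n}` — the factor `n` of the difference derivative is absorbed by the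
geometric sum `v_n = n⁻¹ Σ_{s<n} w^s` (`(1 − w) Σ_{s<n} w^s = 1 − w^n = 1 − e^{−iz}`). [folklore] -/
theorem D_mul_v (n j : ℕ) (hn : n ≠ 0) (z : ℂ) :
    D n j z * v n j z = (1 - cexp (-(I * z))) * cexp (I * (z + 2 * π * j) / n) := by
  have hn' : (n : ℂ) ≠ 0 := Nat.cast_ne_zero.mpr hn
  have hw := exp_mul_w n j z
  have hgeom : (1 - w n j z) * ∑ s ∈ Finset.range n, w n j z ^ s = 1 - cexp (-(I * z)) := by
    rw [mul_neg_geom_sum, w_pow n j hn z]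
  unfold D v
  calc (n : ℂ) * (cexp (I * (z + 2 * π * j) / n) - 1) * ((n : ℂ)⁻¹ * ∑ s ∈ Finset.range n, w n j z ^ s)
      = (cexp (I * (z + 2 * π * j) / n) - 1) * ∑ s ∈ Finset.range n, w n j z ^ s := by
        field_simp
    _ = cexp (I * (z + 2 * π * j) / n) * ((1 - w n j z) * ∑ s ∈ Finset.range n, w n j z ^ s) := by
        have : cexp (I * (z + 2 * π * j) / n) - 1 = cexp (I * (z + 2 * π * j) / n) * (1 - w n j z) := by
          linear_combination hw
        rw [this, mul_assoc]
    _ = (1 - cexp (-(I * z))) * cexp (I * (z + 2 * π * j) / n) := by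
        rw [hgeom, mul_comm]

/-- `|e^{i(z+2πj)/n}| ≤ 2` for `|Im z| ≤ 1/2`. [folklore] -/
theorem norm_exp_le_two (n j : ℕ) {z : ℂ} (hy : |z.im| ≤ 1 / 2) : ‖cexp (I * (z + 2 * π * j) / n)‖ ≤ 2 := by
  rw [Complex.norm_exp]
  refine (exp_lt_two ?_).le
  have hre : (I * (z + 2 * π * j) / n).re = -(z.im / n) := by
    simp [Complex.mul_re, Complex.mul_im, mul_div_assoc]
  rw [hre]
  rcases Nat.eq_zero_or_pos n with h0 | hpos
  · subst h0; simp
  · have hnr : (1 : ℝ) ≤ n := by exact_mod_cast hpos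
    have h1 : -(z.im / n) ≤ |z.im| / n := by
      rw [neg_le]
      have := neg_abs_le z.im
      have hn0 : (0 : ℝ) < n := by linarith
      rw [← neg_div]
      exact div_le_div_of_nonneg_right this hn0.le
    have h2 : |z.im| / n ≤ |z.im| := div_le_self (abs_nonneg _) hnr
    linarith

/-- **THE BOUND OF THE CANCELLED FACTOR**: `|D_n(j; z) v_n(j; z)| ≤ 6` for `|Im z| ≤ 1/2` — uniformly in `n` and `j`
(whereas `|D_n(j; z)|` alone is of order `n`). [folklore] -/
theorem norm_D_mul_v_le (n j : ℕ) (hn : n ≠ 0) {z : ℂ} (hy : |z.im| ≤ 1 / 2) : ‖D n j z * v n j z‖ ≤ 6 := by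
  rw [D_mul_v n j hn z, norm_mul]
  have h1 : ‖1 - cexp (-(I * z))‖ ≤ 3 := by
    have him : (-(I * z)).re = z.im := by simp
    calc ‖1 - cexp (-(I * z))‖ ≤ ‖(1 : ℂ)‖ + ‖cexp (-(I * z))‖ := norm_sub_le _ _
      _ = 1 + Real.exp z.im := by rw [norm_one, Complex.norm_exp, him]
      _ ≤ 1 + 2 := by
          have := (exp_lt_two (t := z.im) (by linarith [le_abs_self z.im])).le
          linarith
      _ = 3 := by norm_num
  have h2 := norm_exp_le_two n j hy
  calc ‖1 - cexp (-(I * z))‖ * ‖cexp (I * (z + 2 * π * j) / n)‖ ≤ 3 * 2 :=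
      mul_le_mul h1 h2 (norm_nonneg _) (by norm_num)
    _ = 6 := by norm_num

/-- `D` is `2π`-periodic up to the residue shift `j ↦ j+1 (mod n)` (as `w`, `v`, `ef`). [folklore] -/
theorem D_add_two_pi (n j : ℕ) (hn : n ≠ 0) (z : ℂ) : D n j (z + 2 * π) = D n ((j + 1) % n) z := by
  rw [D_eq, D_eq, w_add_two_pi n j hn z]

/-- `D` is entire. [folklore] -/
theorem differentiable_D (n j : ℕ) : Differentiable ℂ (D n j) := by
  unfold D; fun_prop

/-! ### §2 The residue sums with a general exponent and the split of the quadratic gain -/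

/-- the `p`-series `ζ(s) = Σ_{i ≥ 1} i^{-s}` (as a real `tsum` over `ℕ`, the term `i = 0` being `0` for `s ≠ 0`). [folklore] -/
def zetaS (s : ℝ) : ℝ := ∑' i : ℕ, (i : ℝ) ^ (-s)

/-- `ζ(s) ≥ 0`. [folklore] -/
theorem zetaS_nonneg (s : ℝ) : 0 ≤ zetaS s :=
  tsum_nonneg (fun i => Real.rpow_nonneg (Nat.cast_nonneg i) _)

/-- the `p`-series converges for `s > 1` (`Real.summable_nat_rpow`). [folklore] -/
theorem summable_zetaS {s : ℝ} (hs : 1 < s) : Summable (fun i : ℕ => (i : ℝ) ^ (-s)) :=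
  Real.summable_nat_rpow.mpr (by linarith)

/-- a partial `p`-series is bounded by the series. [folklore] -/
theorem sum_rpow_le_zetaS {s : ℝ} (hs : 1 < s) (n : ℕ) :
    ∑ j : Fin n, (((j : ℕ) : ℝ) + 1) ^ (-s) ≤ zetaS s := by
  set e := -s with he
  have he0 : e ≠ 0 := by rw [he]; linarith
  have hS : Summable (fun m : ℕ => (m : ℝ) ^ e) := summable_zetaS hs
  have hS1 : Summable (fun m : ℕ => ((m + 1 : ℕ) : ℝ) ^ e) := (summable_nat_add_iff 1).mpr hS
  have h1 : ∑ j : Fin n, (((j : ℕ) : ℝ) + 1) ^ e = ∑ i ∈ Finset.range n, ((i : ℝ) + 1) ^ e :=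
    Fin.sum_univ_eq_sum_range (fun i => ((i : ℝ) + 1) ^ e) n
  have h2 : ∑ i ∈ Finset.range n, ((i : ℝ) + 1) ^ e = ∑ i ∈ Finset.range n, ((i + 1 : ℕ) : ℝ) ^ e := by
    refine Finset.sum_congr rfl (fun i _ => ?_); push_cast; rfl
  have h3 : ∑ i ∈ Finset.range n, ((i + 1 : ℕ) : ℝ) ^ e ≤ ∑' m : ℕ, ((m + 1 : ℕ) : ℝ) ^ e :=
    hS1.sum_le_tsum (Finset.range n) (fun m _ => Real.rpow_nonneg (Nat.cast_nonneg _) _)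
  have h4 : ∑' m : ℕ, ((m + 1 : ℕ) : ℝ) ^ e = zetaS s := by
    rw [zetaS, ← he, hS.tsum_eq_zero_add]
    simp [Real.zero_rpow he0]
  linarith [h1, h2, h3, h4]

/-- **THE `n`-UNIFORM RESIDUE SUM with a general exponent**: `Σ_{j ∈ ℤ_n} ω_n(j)^{-s} ≤ 2 ζ(s)` for `s > 1`. [folklore] -/
theorem sum_omega_rpow_le_zetaS (n : ℕ) {s : ℝ} (hs : 1 < s) :
    ∑ j : Fin n, omega n j ^ (-s) ≤ 2 * zetaS s := by
  set e := -s with he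
  have hterm : ∀ j : Fin n, omega n j ^ e ≤ (((j : ℕ) : ℝ) + 1) ^ e + ((n : ℝ) - (j : ℕ)) ^ e := by
    intro j
    have hjn : ((j : ℕ) : ℝ) + 1 ≤ n := by exact_mod_cast j.isLt
    have ha : 0 ≤ (((j : ℕ) : ℝ) + 1) ^ e := Real.rpow_nonneg (by positivity) _
    have hb : 0 ≤ ((n : ℝ) - (j : ℕ)) ^ e := Real.rpow_nonneg (by linarith) _
    unfold omega
    rcases min_choice (((j : ℕ) : ℝ) + 1) ((n : ℝ) - (j : ℕ)) with h | h <;> rw [h] <;> linarith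
  calc ∑ j : Fin n, omega n j ^ e
      ≤ ∑ j : Fin n, ((((j : ℕ) : ℝ) + 1) ^ e + ((n : ℝ) - (j : ℕ)) ^ e) :=
        Finset.sum_le_sum (fun j _ => hterm j)
    _ = 2 * ∑ j : Fin n, (((j : ℕ) : ℝ) + 1) ^ e := by
        rw [Finset.sum_add_distrib, sum_reflect_rpow]; ring
    _ ≤ 2 * zetaS s := by
        have := sum_rpow_le_zetaS hs n
        linarith

/-- `W` over `d+1` coordinates splits off the coordinate `μ`. [folklore] -/
theorem W_succAbove (n : ℕ) (k : Fin (d + 1) → Fin n) (μ : Fin (d + 1)) :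
    W n k = (if (k μ : ℕ) = 0 then 0 else omega n (k μ) ^ 2) + W n (fun i => k (μ.succAbove i)) := by
  unfold W
  rw [Fin.sum_univ_succAbove _ μ]

/-- the quadratic gain of the OTHER coordinates: `1/W_n(k) ≤ Π_{ν ≠ μ} ω_n(k_ν)^{-2/(d+1)}` for `k ≠ 0` (the exponent `-2/d`
of `B4StripSums.inv_W_le_prod_rpow` weakened to `-2/(d+1)` so that `d = 0` needs no case). [folklore] -/
theorem inv_W_le_prod_other (n : ℕ) [NeZero n] (k : Fin (d + 1) → Fin n) (hk : k ≠ fun _ => 0)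
    (μ : Fin (d + 1)) : 1 / W n k ≤ ∏ i : Fin d, omega n (k (μ.succAbove i)) ^ (-(2 : ℝ) / (d + 1)) := by
  have hn : 1 ≤ n := Nat.one_le_iff_ne_zero.mpr (NeZero.ne n)
  have hW1 := one_le_W n k hk
  have hW0 : 0 < W n k := by linarith
  set k' : Fin d → Fin n := fun i => k (μ.succAbove i) with hk'def
  by_cases hk' : k' = fun _ => 0
  · have h1 : ∏ i : Fin d, omega n (k (μ.succAbove i)) ^ (-(2 : ℝ) / (d + 1)) = 1 := by
      refine Finset.prod_eq_one (fun i _ => ?_)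
      have hi : k (μ.succAbove i) = 0 := congrFun hk' i
      rw [hi, Fin.val_zero, omega_zero n hn, Real.one_rpow]
    rw [h1, div_le_one hW0]
    exact hW1
  · have hd : 0 < d := by
      rcases Nat.eq_zero_or_pos d with h0 | hpos
      · exfalso
        apply hk'
        funext i
        subst h0
        exact i.elim0
      · exact hpos
    have hW1' := one_le_W n k' hk'
    have hle : W n k' ≤ W n k := by
      rw [W_succAbove n k μ]
      have : 0 ≤ (if (k μ : ℕ) = 0 then (0 : ℝ) else omega n (k μ) ^ 2) := by
        split_ifs
        · exact le_rfl
        · positivity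
      linarith
    have h1 : 1 / W n k ≤ 1 / W n k' := one_div_le_one_div_of_le (by linarith) hle
    have h2 := inv_W_le_prod_rpow n hd k' hk'
    have hdr : (0 : ℝ) < d := by exact_mod_cast hd
    have hexp : -(2 : ℝ) / d ≤ -(2 : ℝ) / (d + 1) := by
      rw [neg_div, neg_div, neg_le_neg_iff]
      exact div_le_div_of_nonneg_left (by norm_num) hdr (by linarith)
    have h3 : ∏ i : Fin d, omega n (k' i) ^ (-(2 : ℝ) / d)
        ≤ ∏ i : Fin d, omega n (k (μ.succAbove i)) ^ (-(2 : ℝ) / (d + 1)) :=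
      Finset.prod_le_prod (fun i _ => Real.rpow_nonneg (omega_pos n (k' i) (k' i).isLt).le _)
        (fun i _ => Real.rpow_le_rpow_of_exponent_le (one_le_omega n (k' i) (k' i).isLt) hexp)
    exact h1.trans (h2.trans h3)

/-- **THE SPLIT OF THE QUADRATIC GAIN**: for `k ≠ 0`,
`1/W_n(k) ≤ ω_n(k_μ)^{-3/2} · Π_{ν ≠ μ} ω_n(k_ν)^{-1/(2(d+1))}` (`1/W = (1/W)^{3/4} (1/W)^{1/4}`, `W ≥ ω_n(k_μ)²`,
`W ≥ Π_{ν≠μ} ω^{2/(d+1)}`): three quarters of the gain pay for the lost decay of the differentiated coordinate, one quarter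
keeps the other coordinates summable. [folklore] -/
theorem inv_W_le_split (n : ℕ) [NeZero n] (k : Fin (d + 1) → Fin n) (hk : k ≠ fun _ => 0) (μ : Fin (d + 1)) :
    1 / W n k ≤ omega n (k μ) ^ (-(3 / 2 : ℝ))
      * ∏ i : Fin d, omega n (k (μ.succAbove i)) ^ (-(1 : ℝ) / (2 * (d + 1))) := by
  have hW1 := one_le_W n k hk
  have hW0 : 0 < W n k := by linarith
  have hx : 0 ≤ 1 / W n k := by positivity
  have hω := omega_pos n (k μ) (k μ).isLt
  have hA : 1 / W n k ≤ omega n (k μ) ^ (-(2 : ℝ)) := by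
    have h := omega_sq_le_W n k hk μ
    rw [Real.rpow_neg hω.le, Real.rpow_two, one_div]
    exact inv_anti₀ (by positivity) h
  have hB := inv_W_le_prod_other n k hk μ
  have hsplit : 1 / W n k = (1 / W n k) ^ (3 / 4 : ℝ) * (1 / W n k) ^ (1 / 4 : ℝ) := by
    rw [← Real.rpow_add (by positivity : 0 < 1 / W n k)]
    norm_num
  rw [hsplit]
  have hP0 : ∀ i : Fin d, 0 ≤ omega n (k (μ.succAbove i)) ^ (-(2 : ℝ) / (d + 1)) :=
    fun i => Real.rpow_nonneg (omega_pos n _ (k (μ.succAbove i)).isLt).le _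
  apply mul_le_mul
  · calc (1 / W n k) ^ (3 / 4 : ℝ) ≤ (omega n (k μ) ^ (-(2 : ℝ))) ^ (3 / 4 : ℝ) :=
          Real.rpow_le_rpow hx hA (by norm_num)
      _ = omega n (k μ) ^ (-(3 / 2 : ℝ)) := by
          rw [← Real.rpow_mul hω.le]
          norm_num
  · calc (1 / W n k) ^ (1 / 4 : ℝ)
        ≤ (∏ i : Fin d, omega n (k (μ.succAbove i)) ^ (-(2 : ℝ) / (d + 1))) ^ (1 / 4 : ℝ) :=
          Real.rpow_le_rpow hx hB (by norm_num)
      _ = ∏ i : Fin d, (omega n (k (μ.succAbove i)) ^ (-(2 : ℝ) / (d + 1))) ^ (1 / 4 : ℝ) :=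
          (Real.finsetProd_rpow _ _ (fun i _ => hP0 i) _).symm
      _ = ∏ i : Fin d, omega n (k (μ.succAbove i)) ^ (-(1 : ℝ) / (2 * (d + 1))) := by
          refine Finset.prod_congr rfl (fun i _ => ?_)
          rw [← Real.rpow_mul (omega_pos n _ (k (μ.succAbove i)).isLt).le]
          congr 1
          field_simp
          ring
  · positivity
  · positivity


/-! ### §3 The differentiated regrouped multiplier of (2.49) and its uniform bound on the fat region -/

/-- the exponent `s_d = 1 + 1/(2(d+1)) > 1` of the residue sums of the undifferentiated coordinates. [folklore] -/
def sD (d : ℕ) : ℝ := 1 + 1 / (2 * ((d : ℝ) + 1))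

/-- `s_d > 1`. [folklore] -/
theorem one_lt_sD (d : ℕ) : 1 < sD d := by
  unfold sD
  have : (0 : ℝ) ≤ d := Nat.cast_nonneg d
  have : (0 : ℝ) < 1 / (2 * ((d : ℝ) + 1)) := by positivity
  linarith

/-- one term of the DIFFERENTIATED `l`-sum: `∂^ξ_μ(p′+l) · F_{n,τ}(k;p′) R_k(p′)/E(p′)`, `l = 2πk` — the `l`-th term of (2.48)
multiplied by the printed symbol `∂^ξ_μ(p′+l)` of (2.49) (regrouped through `E` as in `B4StripSums.term`).
[cite: Balaban1983RegularityDecay, (2.48)–(2.49) p.585 (regrouped by the audit)] -/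
def termD (n : ℕ) [NeZero n] (a m2 : ℝ) (τ : Fin d → Fin n) (μ : Fin d) (k : Fin d → Fin n) (p : Fin d → ℂ) : ℂ :=
  D n (k μ : ℕ) (p μ) * term n a m2 τ k p

/-- THE FOURIER MULTIPLIER OF `∂^ξ_μ G_j Q_j^*` AT BLOCK OFFSET `τ`:
`GD_{n,a,m²,τ,μ}(p′) = Σ_{k ∈ {0..n-1}^d} n(e^{i(p′_μ+2πk_μ)/n} − 1) e^{i(p′+2πk)·τ/n} u(p′+2πk) R_k(p′)/E(p′)`; for
`x = x⁰ + τ/n`, `x⁰, y ∈ ℤ^d`, the kernel `(∂^ξ_μ G_jQ_j^*)(x, y) = n[(G_jQ_j^*)(x + e_μ/n, y) − (G_jQ_j^*)(x, y)]`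
(difference derivative in `x`, p. 573) is `(2π)^{-d} ∫_{[-π,π]^d} GD(p′) e^{ip′·(x⁰−y)} dp′ = latticeKernel GD (x⁰ − y)`.
[cite: Balaban1983RegularityDecay, (2.35) p.582 with (2.48)–(2.49) p.585 (regrouped by the audit)] -/
def GD (n : ℕ) [NeZero n] (a m2 : ℝ) (τ : Fin d → Fin n) (μ : Fin d) (p : Fin d → ℂ) : ℂ :=
  ∑ k : Fin d → Fin n, termD n a m2 τ μ k p

/-- THE DICTIONARY WITH (2.48)–(2.49), whole differentiated summand: where `(Δ^ξ+m²)(p′)`, `(Δ^ξ+m²)(p′+2πk)` and the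
bracket `B` do not vanish, `termD_k(p′) = ∂^ξ_μ(p′+l) e^{i(p′+l)·ξτ} u_j(p′+l) / [(Δ^ξ+m²)(p′+l) · (1 + a Σ_{l′} |u_j(p′+l′)|²
(Δ^ξ(p′+l′)+m²)^{-1})]`, `l = 2πk`. [cite: Balaban1983RegularityDecay, (2.48)–(2.49) p.585] -/
theorem termD_eq_printed (n : ℕ) [NeZero n] (a m2 : ℝ) (τ : Fin d → Fin n) (μ : Fin d) (k : Fin d → Fin n)
    (p : Fin d → ℂ) (h0 : DeltaXi n m2 p ≠ 0) (hk : DeltaXi n m2 (shift n k p) ≠ 0) (hB : Bfac n a m2 p ≠ 0) :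
    termD n a m2 τ μ k p = D n (k μ : ℕ) (p μ) * F n τ k p / (DeltaXi n m2 (shift n k p) * Bfac n a m2 p) := by
  unfold termD
  rw [term_eq_printed n a m2 τ k p h0 hk hB, mul_div_assoc]

/-- `|∂^ξ_μ · F_{n,τ}(k; p)| ≤ 12 Π_{ν ≠ μ} 24/ω_n(k_ν)` on the fat region (`r ≤ 1/4`): the differentiated coordinate
contributes `|e^{…}| |D v| ≤ 2 · 6`, the others `24/ω` as in `B4StripSums.norm_F_le`. [folklore] -/
theorem norm_D_mul_F_le (n : ℕ) [NeZero n] {r : ℝ} (hr : r ≤ 1 / 4) (τ k : Fin (d + 1) → Fin n) (μ : Fin (d + 1))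
    {p : Fin (d + 1) → ℂ} (hp : p ∈ Fat (d + 1) r) :
    ‖D n (k μ : ℕ) (p μ) * F n τ k p‖ ≤ 12 * ∏ i : Fin d, 24 / omega n (k (μ.succAbove i)) := by
  unfold F
  rw [Fin.prod_univ_succAbove _ μ, ← mul_assoc, norm_mul, norm_prod]
  have hμ : ‖D n (k μ : ℕ) (p μ) * (ef n (k μ : ℕ) (τ μ : ℕ) (p μ) * v n (k μ : ℕ) (p μ))‖ ≤ 12 := by
    rw [show D n (k μ : ℕ) (p μ) * (ef n (k μ : ℕ) (τ μ : ℕ) (p μ) * v n (k μ : ℕ) (p μ))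
        = ef n (k μ : ℕ) (τ μ : ℕ) (p μ) * (D n (k μ : ℕ) (p μ) * v n (k μ : ℕ) (p μ)) by ring, norm_mul]
    have h1 := norm_ef_le n (k μ) (τ μ) (τ μ).isLt.le (z := p μ) (by linarith [(hp μ).2])
    have h2 := norm_D_mul_v_le n (k μ) (NeZero.ne n) (z := p μ) (by linarith [(hp μ).2])
    calc ‖ef n (k μ : ℕ) (τ μ : ℕ) (p μ)‖ * ‖D n (k μ : ℕ) (p μ) * v n (k μ : ℕ) (p μ)‖ ≤ 2 * 6 :=
        mul_le_mul h1 h2 (norm_nonneg _) (by norm_num)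
      _ = 12 := by norm_num
  have hν : ∀ i : Fin d, ‖ef n (k (μ.succAbove i) : ℕ) (τ (μ.succAbove i) : ℕ) (p (μ.succAbove i))
      * v n (k (μ.succAbove i) : ℕ) (p (μ.succAbove i))‖ ≤ 24 / omega n (k (μ.succAbove i)) := by
    intro i
    set ν := μ.succAbove i
    rw [norm_mul]
    have h1 := norm_ef_le n (k ν) (τ ν) (τ ν).isLt.le (z := p ν) (by linarith [(hp ν).2])
    have h2 := norm_v_le n (k ν) hr (hp ν).1 (hp ν).2
    calc ‖ef n (k ν : ℕ) (τ ν : ℕ) (p ν)‖ * ‖v n (k ν : ℕ) (p ν)‖ ≤ 2 * (12 / omega n (k ν)) :=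
        mul_le_mul h1 h2 (norm_nonneg _) (by norm_num)
      _ = 24 / omega n (k ν) := by ring
  exact mul_le_mul hμ (Finset.prod_le_prod (fun _ _ => norm_nonneg _) (fun i _ => hν i))
    (Finset.prod_nonneg (fun _ _ => norm_nonneg _)) (by norm_num)

/-- `|R_k| ≤ C_R ω_n(k_μ)^{-3/2} Π_{ν≠μ} ω_n(k_ν)^{-1/(2(d+1))}` for EVERY `k` on the fat region (the split form of the
quadratic gain; `k = 0`: `R = 1 ≤ C_R`). [folklore] -/
theorem norm_R_le_split (n : ℕ) [NeZero n] (m2 : ℝ) (hm : 0 ≤ m2) {r : ℝ} (hr : r ≤ 1 / 4)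
    (hdr : ((d + 1 : ℕ) : ℝ) * r ^ 2 ≤ 1 / 16) {q : Fin (d + 1) → ℂ} (hq : q ∈ Fat (d + 1) r)
    (k : Fin (d + 1) → Fin n) (μ : Fin (d + 1)) :
    ‖R n m2 k q‖ ≤ CR (d + 1) m2 * (omega n (k μ) ^ (-(3 / 2 : ℝ))
      * ∏ i : Fin d, omega n (k (μ.succAbove i)) ^ (-(1 : ℝ) / (2 * (d + 1)))) := by
  have hn : 1 ≤ n := Nat.one_le_iff_ne_zero.mpr (NeZero.ne n)
  have hd0 : (0 : ℝ) ≤ (16 * ((d + 1 : ℕ) : ℝ) + m2) * (64 / 7) := by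
    have : (0 : ℝ) ≤ ((d + 1 : ℕ) : ℝ) := Nat.cast_nonneg _
    nlinarith
  have hCR1 : 1 ≤ CR (d + 1) m2 := by unfold CR; linarith
  by_cases hk : k = fun _ => 0
  · have h1 : ‖R n m2 k q‖ = 1 := by unfold R; rw [if_pos hk, norm_one]
    have h2 : omega n (k μ) ^ (-(3 / 2 : ℝ)) = 1 := by
      rw [hk, Fin.val_zero, omega_zero n hn, Real.one_rpow]
    have h3 : ∏ i : Fin d, omega n (k (μ.succAbove i)) ^ (-(1 : ℝ) / (2 * (d + 1))) = 1 := by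
      refine Finset.prod_eq_one (fun i _ => ?_)
      rw [hk, Fin.val_zero, omega_zero n hn, Real.one_rpow]
    rw [h1, h2, h3, mul_one, mul_one]
    exact hCR1
  · have h1 := norm_R_le n m2 hm hr hdr hq k hk
    have h2 := inv_W_le_split n k hk μ
    have hP0 : 0 ≤ omega n (k μ) ^ (-(3 / 2 : ℝ))
        * ∏ i : Fin d, omega n (k (μ.succAbove i)) ^ (-(1 : ℝ) / (2 * (d + 1))) :=
      mul_nonneg (Real.rpow_nonneg (omega_pos n _ (k μ).isLt).le _)
        (Finset.prod_nonneg (fun i _ => Real.rpow_nonneg (omega_pos n _ (k (μ.succAbove i)).isLt).le _))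
    calc ‖R n m2 k q‖ ≤ (16 * ((d + 1 : ℕ) : ℝ) + m2) * (64 / 7) / W n k := h1
      _ = (16 * ((d + 1 : ℕ) : ℝ) + m2) * (64 / 7) * (1 / W n k) := by ring
      _ ≤ (16 * ((d + 1 : ℕ) : ℝ) + m2) * (64 / 7) * (omega n (k μ) ^ (-(3 / 2 : ℝ))
          * ∏ i : Fin d, omega n (k (μ.succAbove i)) ^ (-(1 : ℝ) / (2 * (d + 1)))) :=
          mul_le_mul_of_nonneg_left h2 hd0
      _ ≤ CR (d + 1) m2 * (omega n (k μ) ^ (-(3 / 2 : ℝ))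
          * ∏ i : Fin d, omega n (k (μ.succAbove i)) ^ (-(1 : ℝ) / (2 * (d + 1)))) :=
          mul_le_mul_of_nonneg_right (by unfold CR; linarith) hP0

/-- the bound of one differentiated term on the fat region where `|E| ≥ c`:
`|termD_k| ≤ c⁻¹ · 12 C_R · ω_n(k_μ)^{-3/2} · Π_{ν≠μ} 24 ω_n(k_ν)^{-s_d}`. [folklore] -/
theorem norm_termD_le (n : ℕ) [NeZero n] (a m2 : ℝ) (hm : 0 ≤ m2) {r : ℝ} (hr : r ≤ 1 / 4)
    (hdr : ((d + 1 : ℕ) : ℝ) * r ^ 2 ≤ 1 / 16) {p : Fin (d + 1) → ℂ} (hp : p ∈ Fat (d + 1) r) {c : ℝ}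
    (hc : 0 < c) (hE : c ≤ ‖E n a m2 p‖) (τ : Fin (d + 1) → Fin n) (μ : Fin (d + 1)) (k : Fin (d + 1) → Fin n) :
    ‖termD n a m2 τ μ k p‖ ≤ c⁻¹ * (12 * CR (d + 1) m2)
      * (omega n (k μ) ^ (-(3 / 2 : ℝ)) * ∏ i : Fin d, 24 * omega n (k (μ.succAbove i)) ^ (-(sD d))) := by
  have hterm : termD n a m2 τ μ k p = D n (k μ : ℕ) (p μ) * F n τ k p * R n m2 k p / E n a m2 p := by
    unfold termD term; ring
  rw [hterm, norm_div, norm_mul]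
  have hF := norm_D_mul_F_le n hr τ k μ hp
  have hR := norm_R_le_split n m2 hm hr hdr hp k μ
  have hE' : ‖E n a m2 p‖⁻¹ ≤ c⁻¹ := inv_anti₀ hc hE
  have hP1 : 0 ≤ 12 * ∏ i : Fin d, 24 / omega n (k (μ.succAbove i)) :=
    mul_nonneg (by norm_num) (Finset.prod_nonneg (fun i _ =>
      div_nonneg (by norm_num) (omega_pos n _ (k (μ.succAbove i)).isLt).le))
  have hωμ : 0 ≤ omega n (k μ) ^ (-(3 / 2 : ℝ)) := Real.rpow_nonneg (omega_pos n _ (k μ).isLt).le _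
  have hP0 : 0 ≤ ∏ i : Fin d, omega n (k (μ.succAbove i)) ^ (-(1 : ℝ) / (2 * (d + 1))) :=
    Finset.prod_nonneg (fun i _ => Real.rpow_nonneg (omega_pos n _ (k (μ.succAbove i)).isLt).le _)
  have hCR := CR_nonneg (d + 1) hm
  have hprod : (∏ i : Fin d, 24 / omega n (k (μ.succAbove i)))
      * ∏ i : Fin d, omega n (k (μ.succAbove i)) ^ (-(1 : ℝ) / (2 * (d + 1)))
      = ∏ i : Fin d, 24 * omega n (k (μ.succAbove i)) ^ (-(sD d)) := by
    rw [← Finset.prod_mul_distrib]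
    refine Finset.prod_congr rfl (fun i _ => ?_)
    have hω := omega_pos n _ (k (μ.succAbove i)).isLt
    rw [div_eq_mul_inv, ← Real.rpow_neg_one, mul_assoc, ← Real.rpow_add hω]
    congr 1
    unfold sD
    field_simp
    ring
  calc ‖D n (k μ : ℕ) (p μ) * F n τ k p‖ * ‖R n m2 k p‖ / ‖E n a m2 p‖
      = ‖D n (k μ : ℕ) (p μ) * F n τ k p‖ * ‖R n m2 k p‖ * ‖E n a m2 p‖⁻¹ := div_eq_mul_inv _ _
    _ ≤ ((12 * ∏ i : Fin d, 24 / omega n (k (μ.succAbove i)))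
          * (CR (d + 1) m2 * (omega n (k μ) ^ (-(3 / 2 : ℝ))
            * ∏ i : Fin d, omega n (k (μ.succAbove i)) ^ (-(1 : ℝ) / (2 * (d + 1)))))) * c⁻¹ := by
        apply mul_le_mul (mul_le_mul hF hR (norm_nonneg _) hP1) hE' (inv_nonneg.mpr (norm_nonneg _))
        positivity
    _ = c⁻¹ * (12 * CR (d + 1) m2) * (omega n (k μ) ^ (-(3 / 2 : ℝ))
          * ((∏ i : Fin d, 24 / omega n (k (μ.succAbove i)))
            * ∏ i : Fin d, omega n (k (μ.succAbove i)) ^ (-(1 : ℝ) / (2 * (d + 1))))) := by ring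
    _ = c⁻¹ * (12 * CR (d + 1) m2)
          * (omega n (k μ) ^ (-(3 / 2 : ℝ)) * ∏ i : Fin d, 24 * omega n (k (μ.succAbove i)) ^ (-(sD d))) := by
        rw [hprod]

/-- the sum over the undifferentiated residues: `Σ_{k′ ∈ ℤ_n^d} Π_i 24 ω_n(k′_i)^{-s_d} ≤ (48 ζ(s_d))^d`. [folklore] -/
theorem sum_prod_other_le (n : ℕ) (d : ℕ) :
    ∑ k' : Fin d → Fin n, ∏ i, 24 * omega n (k' i) ^ (-(sD d)) ≤ (48 * zetaS (sD d)) ^ d := by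
  have h := Finset.prod_univ_sum (fun _ : Fin d => (Finset.univ : Finset (Fin n)))
    (fun _ j => 24 * omega n (j : ℕ) ^ (-(sD d)))
  rw [Fintype.piFinset_univ] at h
  rw [← h]
  have hS : ∑ j : Fin n, 24 * omega n (j : ℕ) ^ (-(sD d)) ≤ 48 * zetaS (sD d) := by
    rw [← Finset.mul_sum]
    have := sum_omega_rpow_le_zetaS n (one_lt_sD d)
    linarith
  have hS0 : 0 ≤ ∑ j : Fin n, 24 * omega n (j : ℕ) ^ (-(sD d)) :=
    Finset.sum_nonneg (fun j _ => mul_nonneg (by norm_num) (Real.rpow_nonneg (omega_pos n j j.isLt).le _))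
  calc ∏ _i : Fin d, ∑ j : Fin n, 24 * omega n (j : ℕ) ^ (-(sD d))
      ≤ ∏ _i : Fin d, (48 * zetaS (sD d)) := Finset.prod_le_prod (fun _ _ => hS0) (fun _ _ => hS)
    _ = (48 * zetaS (sD d)) ^ d := by simp

/-- **THE `n`-UNIFORM DIFFERENTIATED MULTIPLIER SUM**: separating the coordinate `μ` (`Fin.insertNthEquiv`),
`Σ_{k ∈ ℤ_n^{d+1}} ω_n(k_μ)^{-3/2} Π_{ν≠μ} 24 ω_n(k_ν)^{-s_d} = (Σ_j ω_n(j)^{-3/2}) (Σ_{k′} Π_i 24 ω_n(k′_i)^{-s_d})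
≤ 2ζ(3/2) · (48 ζ(s_d))^d`. [folklore] -/
theorem sum_split_le (n : ℕ) (μ : Fin (d + 1)) :
    ∑ k : Fin (d + 1) → Fin n, omega n (k μ) ^ (-(3 / 2 : ℝ))
        * ∏ i : Fin d, 24 * omega n (k (μ.succAbove i)) ^ (-(sD d))
      ≤ 2 * zetaS (3 / 2) * (48 * zetaS (sD d)) ^ d := by
  have hsep : ∑ k : Fin (d + 1) → Fin n, omega n (k μ) ^ (-(3 / 2 : ℝ))
        * ∏ i : Fin d, 24 * omega n (k (μ.succAbove i)) ^ (-(sD d))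
      = ∑ x : Fin n × (Fin d → Fin n), omega n (x.1 : ℕ) ^ (-(3 / 2 : ℝ))
        * ∏ i : Fin d, 24 * omega n (x.2 i : ℕ) ^ (-(sD d)) :=
    Fintype.sum_equiv (Fin.insertNthEquiv (fun _ => Fin n) μ).symm _ _ (fun k => rfl)
  rw [hsep]
  have hprod : ∑ x : Fin n × (Fin d → Fin n), omega n (x.1 : ℕ) ^ (-(3 / 2 : ℝ))
        * ∏ i : Fin d, 24 * omega n (x.2 i : ℕ) ^ (-(sD d))
      = (∑ j : Fin n, omega n (j : ℕ) ^ (-(3 / 2 : ℝ)))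
        * ∑ k' : Fin d → Fin n, ∏ i : Fin d, 24 * omega n (k' i : ℕ) ^ (-(sD d)) := by
    rw [Finset.sum_mul_sum, ← Finset.univ_product_univ, Finset.sum_product]
  rw [hprod]
  have h1 := sum_omega_rpow_le_zetaS n (s := 3 / 2) (by norm_num)
  have h2 := sum_prod_other_le n d
  have h10 : 0 ≤ ∑ j : Fin n, omega n (j : ℕ) ^ (-(3 / 2 : ℝ)) :=
    Finset.sum_nonneg (fun j _ => Real.rpow_nonneg (omega_pos n j j.isLt).le _)
  have h20 : 0 ≤ (48 * zetaS (sD d)) ^ d := by have := zetaS_nonneg (sD d); positivity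
  exact mul_le_mul h1 h2 (Finset.sum_nonneg (fun k _ => Finset.prod_nonneg (fun i _ =>
    mul_nonneg (by norm_num) (Real.rpow_nonneg (omega_pos n _ (k i).isLt).le _))))
    (mul_nonneg (by norm_num) (zetaS_nonneg _))

/-- the uniform bound `M_D(d, c, m²₊) = c⁻¹ · 12 C_R(d+1, m²₊) · 2ζ(3/2) · (48 ζ(s_d))^d` of the differentiated multiplier.
[folklore] -/
def boundGD (d : ℕ) (c m2plus : ℝ) : ℝ :=
  c⁻¹ * (12 * CR (d + 1) m2plus) * (2 * zetaS (3 / 2) * (48 * zetaS (sD d)) ^ d)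

/-- the uniform bound is `≥ 0`. [folklore] -/
theorem boundGD_nonneg (d : ℕ) {c m2plus : ℝ} (hc : 0 < c) (hm : 0 ≤ m2plus) : 0 ≤ boundGD d c m2plus := by
  unfold boundGD
  have := CR_nonneg (d + 1) hm
  have := zetaS_nonneg (3 / 2)
  have := zetaS_nonneg (sD d)
  positivity

/-- **THE UNIFORM BOUND OF THE DIFFERENTIATED MULTIPLIER ON THE FAT REGION**: where `|E(p′)| ≥ c > 0`,
`|GD_{n,a,m²,τ,μ}(p′)| ≤ boundGD d c m²₊` — independent of `n = L^j`, of `τ`, of `μ`, of `a`, and of `m² ∈ [0, m²₊]`.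
[folklore] -/
theorem norm_GD_le (n : ℕ) [NeZero n] (a m2 m2plus : ℝ) (hm : 0 ≤ m2) (hmp : m2 ≤ m2plus)
    {r : ℝ} (hr : r ≤ 1 / 4) (hdr : ((d + 1 : ℕ) : ℝ) * r ^ 2 ≤ 1 / 16) {p : Fin (d + 1) → ℂ}
    (hp : p ∈ Fat (d + 1) r) {c : ℝ} (hc : 0 < c) (hE : c ≤ ‖E n a m2 p‖) (τ : Fin (d + 1) → Fin n)
    (μ : Fin (d + 1)) : ‖GD n a m2 τ μ p‖ ≤ boundGD d c m2plus := by
  unfold GD boundGD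
  have hCR := CR_nonneg (d + 1) hm
  have hsum := sum_split_le n μ (d := d)
  calc ‖∑ k : Fin (d + 1) → Fin n, termD n a m2 τ μ k p‖
      ≤ ∑ k : Fin (d + 1) → Fin n, ‖termD n a m2 τ μ k p‖ := norm_sum_le _ _
    _ ≤ ∑ k : Fin (d + 1) → Fin n, c⁻¹ * (12 * CR (d + 1) m2)
          * (omega n (k μ) ^ (-(3 / 2 : ℝ)) * ∏ i : Fin d, 24 * omega n (k (μ.succAbove i)) ^ (-(sD d))) :=
        Finset.sum_le_sum (fun k _ => norm_termD_le n a m2 hm hr hdr hp hc hE τ μ k)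
    _ = c⁻¹ * (12 * CR (d + 1) m2) * ∑ k : Fin (d + 1) → Fin n,
          (omega n (k μ) ^ (-(3 / 2 : ℝ)) * ∏ i : Fin d, 24 * omega n (k (μ.succAbove i)) ^ (-(sD d))) := by
        rw [Finset.mul_sum]
    _ ≤ c⁻¹ * (12 * CR (d + 1) m2) * (2 * zetaS (3 / 2) * (48 * zetaS (sD d)) ^ d) :=
        mul_le_mul_of_nonneg_left hsum (by positivity)
    _ ≤ c⁻¹ * (12 * CR (d + 1) m2plus) * (2 * zetaS (3 / 2) * (48 * zetaS (sD d)) ^ d) := by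
        have h1 := CR_mono (d + 1) hmp
        have h2 : 0 ≤ 2 * zetaS (3 / 2) * (48 * zetaS (sD d)) ^ d := by
          have := zetaS_nonneg (3 / 2); have := zetaS_nonneg (sD d); positivity
        have h3 : 0 ≤ c⁻¹ := by positivity
        have h4 : c⁻¹ * (12 * CR (d + 1) m2) ≤ c⁻¹ * (12 * CR (d + 1) m2plus) :=
          mul_le_mul_of_nonneg_left (by linarith) h3
        exact mul_le_mul_of_nonneg_right h4 h2


/-! ### §4 Joint holomorphy of the differentiated multiplier on the fat region -/

/-- one differentiated term is holomorphic (jointly) at every point of the fat region where `E ≠ 0`. [folklore] -/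
theorem differentiableAt_termD (n : ℕ) [NeZero n] (a m2 : ℝ) (hm : 0 ≤ m2) {r : ℝ} (hr : r ≤ 1 / 4)
    (hdr : (d : ℝ) * r ^ 2 ≤ 1 / 16) {q : Fin d → ℂ} (hq : q ∈ Fat d r) (hE : E n a m2 q ≠ 0)
    (τ : Fin d → Fin n) (μ : Fin d) (k : Fin d → Fin n) : DifferentiableAt ℂ (termD n a m2 τ μ k) q := by
  show DifferentiableAt ℂ (fun p => D n (k μ : ℕ) (p μ) * term n a m2 τ k p) q
  have h1 : DifferentiableAt ℂ (fun p : Fin d → ℂ => D n (k μ : ℕ) (p μ)) q :=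
    DifferentiableAt.comp (g := D n (k μ : ℕ)) (f := fun p : Fin d → ℂ => p μ) q
      ((differentiable_D n (k μ)) (q μ)) (differentiableAt_apply (𝕜 := ℂ) μ q)
  exact h1.mul (differentiableAt_term n a m2 hm hr hdr hq hE τ k)

/-- **THE DIFFERENTIATED MULTIPLIER IS HOLOMORPHIC (jointly) at every point of the fat region where `E ≠ 0`.** [folklore] -/
theorem differentiableAt_GD (n : ℕ) [NeZero n] (a m2 : ℝ) (hm : 0 ≤ m2) {r : ℝ} (hr : r ≤ 1 / 4)
    (hdr : (d : ℝ) * r ^ 2 ≤ 1 / 16) {q : Fin d → ℂ} (hq : q ∈ Fat d r) (hE : E n a m2 q ≠ 0)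
    (τ : Fin d → Fin n) (μ : Fin d) : DifferentiableAt ℂ (GD n a m2 τ μ) q := by
  show DifferentiableAt ℂ (fun p => ∑ k : Fin d → Fin n, termD n a m2 τ μ k p) q
  apply DifferentiableAt.fun_sum
  intro k _
  exact differentiableAt_termD n a m2 hm hr hdr hq hE τ μ k

/-! ### §5 Periodicity across the sides of the strip -/

/-- the derivative symbol relabels under `2π`-shifts: `D_n((k)_μ; (p + 2π e_{μ′})_μ) = D_n((σ_{μ′} k)_μ; p_μ)`. [folklore] -/
theorem D_tr (n : ℕ) [NeZero n] (k : Fin d → Fin n) (p : Fin d → ℂ) (μ' μ : Fin d) :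
    D n (k μ : ℕ) (tr p μ' μ) = D n (sigma n μ' k μ : ℕ) (p μ) := by
  by_cases h : μ = μ'
  · subst h
    rw [tr_apply_self, sigma_apply_self, val_add_one_eq_mod, D_add_two_pi _ _ (NeZero.ne n)]
  · rw [tr_apply_of_ne h, sigma_apply_of_ne n h]

/-- **SIDE PERIODICITY OF ONE DIFFERENTIATED TERM**: at a strip point with `Re p_{μ′} = −π` and `E ≠ 0` at `p` and at
`p + 2π e_{μ′}`, `termD_k(p + 2π e_{μ′}) = termD_{σ_{μ′} k}(p)` (`B4StripSums.term_tr_side` and `D_tr`). [folklore] -/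
theorem termD_tr_side (n : ℕ) [NeZero n] (a m2 : ℝ) (hm : 0 ≤ m2) {κ : ℝ} (hκ1 : κ ≤ 1)
    (hdκ : (d : ℝ) * κ ^ 2 ≤ 1 / 16) {p : Fin d → ℂ} (hp : p ∈ Strip d κ) (μ' : Fin d)
    (hre : (p μ').re = -Real.pi) (hE0 : E n a m2 p ≠ 0) (hE1 : E n a m2 (tr p μ') ≠ 0)
    (τ : Fin d → Fin n) (μ : Fin d) (k : Fin d → Fin n) :
    termD n a m2 τ μ k (tr p μ') = termD n a m2 τ μ (sigma n μ' k) p := by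
  unfold termD
  rw [D_tr, term_tr_side n a m2 hm hκ1 hdκ hp μ' hre hE0 hE1 τ k]

/-- **SIDE PERIODICITY OF THE DIFFERENTIATED MULTIPLIER**: `GD(p + 2π e_{μ′}) = GD(p)` at the strip points with
`Re p_{μ′} = −π` (relabel the `l`-sum by `σ_{μ′}`). [folklore] -/
theorem GD_tr_side (n : ℕ) [NeZero n] (a m2 : ℝ) (hm : 0 ≤ m2) {κ : ℝ} (hκ1 : κ ≤ 1)
    (hdκ : (d : ℝ) * κ ^ 2 ≤ 1 / 16) {p : Fin d → ℂ} (hp : p ∈ Strip d κ) (μ' : Fin d)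
    (hre : (p μ').re = -Real.pi) (hE0 : E n a m2 p ≠ 0) (hE1 : E n a m2 (tr p μ') ≠ 0)
    (τ : Fin d → Fin n) (μ : Fin d) : GD n a m2 τ μ (tr p μ') = GD n a m2 τ μ p := by
  unfold GD
  calc ∑ k : Fin d → Fin n, termD n a m2 τ μ k (tr p μ')
      = ∑ k : Fin d → Fin n, termD n a m2 τ μ (sigma n μ' k) p :=
        Finset.sum_congr rfl (fun k _ => termD_tr_side n a m2 hm hκ1 hdκ hp μ' hre hE0 hE1 τ μ k)
    _ = ∑ k : Fin d → Fin n, termD n a m2 τ μ k p :=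
        Equiv.sum_comp (sigmaEquiv n μ') (fun k => termD n a m2 τ μ k p)

/-! ### §6 Assembly: strip regularity of the differentiated multiplier and the decay of the kernel of `∂^ξ_μ G_j Q_j^*` -/

/-- **STRIP REGULARITY OF THE MULTIPLIER OF `∂^ξ_μ G_j Q_j^*`** in the sense of `B4ContourShift.StripRegular`: on a strip
`Strip (d+1) κ`, `0 ≤ κ ≤ r = 1/(4(d+2))`, on which `|E| ≥ c > 0`, the differentiated multiplier `GD_{n,a,m²,τ,μ}` is
continuous, holomorphic in each coordinate, periodic across the sides, and bounded by `boundGD d c m²₊` — for EVERY `n ≥ 1`,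
`a`, `m² ∈ [0, m²₊]`, every block offset `τ` and every direction `μ`. [folklore] -/
theorem stripRegular_GD (n : ℕ) [NeZero n] (a m2 m2plus : ℝ) (hm : 0 ≤ m2) (hmp : m2 ≤ m2plus)
    (τ : Fin (d + 1) → Fin n) (μ : Fin (d + 1)) {κ c : ℝ} (hκ0 : 0 ≤ κ) (hκr : κ ≤ rOf (d + 1)) (hc : 0 < c)
    (hE : ∀ p ∈ Strip (d + 1) κ, c ≤ ‖E n a m2 p‖) :
    StripRegular (d := d) (GD n a m2 τ μ) κ (boundGD d c m2plus) := by
  obtain ⟨hκ1, hdκ⟩ := kappa_small hκ0 hκr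
  have hfat : Strip (d + 1) κ ⊆ Fat (d + 1) (rOf (d + 1)) := strip_subset_fat (rOf_pos _).le hκr
  have hne : ∀ p ∈ Strip (d + 1) κ, E n a m2 p ≠ 0 := by
    intro p hp h
    have := hE p hp
    rw [h, norm_zero] at this
    linarith
  have hdiffAt : ∀ p ∈ Strip (d + 1) κ, DifferentiableAt ℂ (GD n a m2 τ μ) p := fun p hp =>
    differentiableAt_GD n a m2 hm (rOf_le _) (d_mul_rOf_sq_le _) (hfat hp) (hne p hp) τ μ
  refine ⟨?_, ?_, ?_, ?_⟩
  · exact fun p hp => (hdiffAt p hp).continuousAt.continuousWithinAt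
  · intro i q hq z hz
    have hP : i.insertNth z (ofRealVec q) ∈ Strip (d + 1) κ :=
      insertNth_mem_Strip hκ0 i hq (openRect_subset_closedRect κ hz)
    exact ((hdiffAt _ hP).comp z (differentiableAt_insertNth i _ z)).differentiableWithinAt
  · intro i q hq y hy
    obtain ⟨hP, hre⟩ := insertNth_left_mem hκ0 i hq hy
    rw [← tr_insertNth_left]
    have hP' := tr_mem_Strip hP i hre
    exact (GD_tr_side n a m2 hm hκ1 hdκ hP i hre (hne _ hP) (hne _ hP') τ μ).symm
  · intro p hp
    exact norm_GD_le n a m2 m2plus hm hmp (rOf_le _) (d_mul_rOf_sq_le _) (hfat hp) hc (hE p hp) τ μ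

/-- **B4 LEMMA 2.4 FOR `∂^ξ_μ G_j Q_j^*`, MULTIPLIER FORM.**  For `0 < a₋ ≤ a₊` and `m²₊` there are `κ > 0` and `M ≥ 0` such
that for EVERY `n = L^j ≥ 1`, `a ∈ [a₋, a₊]`, `m² ∈ [0, m²₊]`, every block offset `τ ∈ {0,…,n−1}^{d+1}` and every direction
`μ` the multiplier `GD_{n,a,m²,τ,μ}` of `∂^ξ_μ G_j Q_j^*` is `StripRegular` on `Strip (d+1) κ` with bound `M`.  ONLY HYPOTHESIS:
`0 < a₋`. [cite: Balaban1983RegularityDecay, Lemma 2.4 (2.35) p.582 (second quantity) with (2.48)–(2.51) pp.585–586; proof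
supplied by the audit along the printed method] -/
theorem derivative248_stripRegular (d : ℕ) (aminus aplus m2plus : ℝ) (ha : 0 < aminus) :
    ∃ κ M : ℝ, 0 < κ ∧ 0 ≤ M ∧ ∀ (n : ℕ) [NeZero n] (a m2 : ℝ), aminus ≤ a → a ≤ aplus → 0 ≤ m2 →
      m2 ≤ m2plus → ∀ (τ : Fin (d + 1) → Fin n) (μ : Fin (d + 1)),
        StripRegular (d := d) (GD n a m2 τ μ) κ M := by
  obtain ⟨κ₁, c, hκ₁, hc, h⟩ := uniformStrip_holds (d + 1) aminus aplus m2plus ha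
  refine ⟨min κ₁ (rOf (d + 1)), boundGD d c (max m2plus 0), lt_min hκ₁ (rOf_pos _),
    boundGD_nonneg _ hc (le_max_right _ _), ?_⟩
  intro n _ a m2 ha1 ha2 hm hmp τ μ
  have hκ0 : 0 ≤ min κ₁ (rOf (d + 1)) := (lt_min hκ₁ (rOf_pos _)).le
  have hsub : Strip (d + 1) (min κ₁ (rOf (d + 1))) ⊆ Strip (d + 1) κ₁ := strip_mono (min_le_left _ _)
  exact stripRegular_GD n a m2 (max m2plus 0) hm (hmp.trans (le_max_left _ _)) τ μ hκ0 (min_le_right _ _) hc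
    (fun p hp => h n a m2 ha1 ha2 hm hmp p (hsub hp))

/-- **B4 LEMMA 2.4 (2.35), SECOND QUANTITY — THE `j`-UNIFORM EXPONENTIAL DECAY OF THE KERNEL OF `∂^{L^{-j}}_μ G_j Q_j^*`
(infinite lattice).**  For `0 < a₋ ≤ a₊` and `m²₊` there are `κ > 0`, `M ≥ 0` such that for EVERY `n = L^j ≥ 1`,
`a ∈ [a₋, a₊]`, `m² ∈ [0, m²₊]`, every block offset `τ`, every direction `μ` and every `x ∈ ℤ^{d+1}`:
`|(2π)^{-(d+1)} ∫_{[-π,π]^{d+1}} GD_{n,a,m²,τ,μ}(p′) e^{ip′·x} dp′| ≤ M e^{−κ |x|_∞}`,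
i.e. `|(∂^{L^{-j}}_μ G_jQ_j^*)(y + τ/n, y′)| = |n[(G_jQ_j^*)(y + τ/n + e_μ/n, y′) − (G_jQ_j^*)(y + τ/n, y′)]| ≤ M e^{−κ|y − y′|_∞}`
for `y, y′ ∈ ℤ^{d+1}`.  Assembled from `derivative248_stripRegular` and the generic engine `B4ContourShift.latticeKernel_decay`.
Not covered here: the Hölder bound (2.36), the finite-range operators with boundary conditions (Cor. 2.3, GAPS G-B4-04).
[cite: Balaban1983RegularityDecay, Lemma 2.4 (2.35) p.582 (second quantity) with (2.48)–(2.51) pp.585–586; proof supplied by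
the audit along the printed method] -/
theorem dkernel248_decay (d : ℕ) (aminus aplus m2plus : ℝ) (ha : 0 < aminus) :
    ∃ κ M : ℝ, 0 < κ ∧ 0 ≤ M ∧ ∀ (n : ℕ) [NeZero n] (a m2 : ℝ), aminus ≤ a → a ≤ aplus → 0 ≤ m2 →
      m2 ≤ m2plus → ∀ (τ : Fin (d + 1) → Fin n) (μ : Fin (d + 1)) (x : Fin (d + 1) → ℤ),
        ‖latticeKernel (GD n a m2 τ μ) x‖ ≤ M * Real.exp (-(κ * supNorm x)) := by
  obtain ⟨κ, M, hκ, hM, h⟩ := derivative248_stripRegular d aminus aplus m2plus ha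
  refine ⟨κ, M, hκ, hM, ?_⟩
  intro n _ a m2 ha1 ha2 hm hmp τ μ x
  exact latticeKernel_decay (h n a m2 ha1 ha2 hm hmp τ μ) hκ.le x

/-- Euclidean form of the decay: rate `κ/√(d+1)` in `|x|_2`. [cite: Balaban1983RegularityDecay, Lemma 2.4 (2.35) p.582 (second
quantity); proof supplied by the audit along the printed method] -/
theorem dkernel248_decay_euclid (d : ℕ) (aminus aplus m2plus : ℝ) (ha : 0 < aminus) :
    ∃ κ M : ℝ, 0 < κ ∧ 0 ≤ M ∧ ∀ (n : ℕ) [NeZero n] (a m2 : ℝ), aminus ≤ a → a ≤ aplus → 0 ≤ m2 →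
      m2 ≤ m2plus → ∀ (τ : Fin (d + 1) → Fin n) (μ : Fin (d + 1)) (x : Fin (d + 1) → ℤ),
        ‖latticeKernel (GD n a m2 τ μ) x‖
          ≤ M * Real.exp (-(κ / Real.sqrt (d + 1) * Real.sqrt (∑ i, ((x i : ℝ)) ^ 2))) := by
  obtain ⟨κ, M, hκ, hM, h⟩ := derivative248_stripRegular d aminus aplus m2plus ha
  refine ⟨κ, M, hκ, hM, ?_⟩
  intro n _ a m2 ha1 ha2 hm hmp τ μ x
  exact latticeKernel_decay_euclid (h n a m2 ha1 ha2 hm hmp τ μ) hκ.le hM x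

/-! ### §7 The finite-torus corollary (Poisson periodisation, `B4TorusKernel`) -/

section Torus

open Set UnitAddTorus
open Literature.MathematicalPhysics.QuantumFieldTheory.Balaban1983to89.B4TorusKernel

/-- THE FINITE-TORUS KERNEL OF `∂^ξ_μ G_jQ_j^*` (on the unit torus `Π_ν ℤ/N_ν` of blocks, fine offset `τ`, direction `μ`): at
block separation `x⁰ ∈ ℤ^{d+1}`, `(Π_ν N_ν)^{-1} Σ_{k ∈ Π_ν ℤ/N_ν} GD_{n,a,m²,τ,μ}(p′_k) e^{i p′_k · x⁰}`,
`p′_{k,ν} = 2π rep(k_ν/N_ν)`. [cite: Balaban1983RegularityDecay, (2.35) p.582 with (2.48)–(2.49) p.585 and p.572 (torus);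
dictionary] [folklore] -/
def torusKernelD248 (n : ℕ) [NeZero n] (a m2 : ℝ) (τ : Fin (d + 1) → Fin n) (μ : Fin (d + 1))
    (N : Fin (d + 1) → ℕ) (x : Fin (d + 1) → ℤ) : ℂ :=
  (∏ i, ((N i : ℕ) : ℂ))⁻¹ * ∑ k : (i : Fin (d + 1)) → Fin (N i),
    GD n a m2 τ μ (ofRealVec (fun i => 2 * π * rep (MultiPeriod.gridPt N k i))) * mFourier x (MultiPeriod.gridPt N k)

/-- the finite-torus kernel is the engine's `MultiPeriod.torusKernel` of the descended multiplier (definitional). [folklore] -/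
theorem torusKernelD248_eq_torusKernel (n : ℕ) [NeZero n] (a m2 : ℝ) (τ : Fin (d + 1) → Fin n) (μ : Fin (d + 1))
    {κ M : ℝ} (hreg : StripRegular (d := d) (GD n a m2 τ μ) κ M) (hκ : 0 ≤ κ) (N : Fin (d + 1) → ℕ)
    (x : Fin (d + 1) → ℤ) :
    torusKernelD248 n a m2 τ μ N x = MultiPeriod.torusKernel (descendC _ hreg hκ) N x := rfl

/-- PERIODICITY: `torusKernelD248 … N (x + (N_ν m_ν)_ν) = torusKernelD248 … N x`. [folklore] -/
theorem torusKernelD248_translate (n : ℕ) [NeZero n] (a m2 : ℝ) (τ : Fin (d + 1) → Fin n) (μ : Fin (d + 1))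
    {N : Fin (d + 1) → ℕ} (hN : ∀ i, 1 ≤ N i) (x m : Fin (d + 1) → ℤ) :
    torusKernelD248 n a m2 τ μ N (MultiPeriod.translate N x m) = torusKernelD248 n a m2 τ μ N x := by
  unfold torusKernelD248
  congr 1
  exact Finset.sum_congr rfl fun k _ => by rw [MultiPeriod.mFourier_translate_gridPt hN x m k]

/-- for fixed admissible `a > 0`, `m² ≥ 0` the differentiated multiplier is strip regular with a POSITIVE half-width, for every
`n ≥ 1`, `τ`, `μ`. [folklore] -/
theorem exists_stripRegular_GD {a m2 : ℝ} (ha : 0 < a) (hm : 0 ≤ m2) :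
    ∃ κ M : ℝ, 0 < κ ∧ 0 ≤ M ∧ ∀ (n : ℕ) [NeZero n] (τ : Fin (d + 1) → Fin n) (μ : Fin (d + 1)),
      StripRegular (d := d) (GD n a m2 τ μ) κ M := by
  obtain ⟨κ, M, hκ, hM, h⟩ := derivative248_stripRegular d a a m2 ha
  exact ⟨κ, M, hκ, hM, fun n _ τ μ => h n a m2 le_rfl le_rfl hm le_rfl τ μ⟩

/-- the finite-torus kernel of `∂^ξ_μ G_jQ_j^*` is the periodisation of the infinite-volume one:
`torusKernelD248 n a m2 τ μ N x⁰ = Σ_{m ∈ ℤ^{d+1}} latticeKernel (GD n a m2 τ μ) (x⁰ + (N_ν m_ν)_ν)`.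
[cite: Balaban1984PropagatorsI, p. 36 l. 20–23; Balaban1983RegularityDecay (2.35) p.582; proof supplied by the audit, not printed] -/
theorem torusKernelD248_eq_periodise (n : ℕ) [NeZero n] {a m2 : ℝ} (ha : 0 < a) (hm : 0 ≤ m2)
    (τ : Fin (d + 1) → Fin n) (μ : Fin (d + 1)) {N : Fin (d + 1) → ℕ} (hN : ∀ i, 1 ≤ N i)
    (x : Fin (d + 1) → ℤ) :
    torusKernelD248 n a m2 τ μ N x
      = ∑' m : Fin (d + 1) → ℤ, latticeKernel (GD n a m2 τ μ) (MultiPeriod.translate N x m) := by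
  obtain ⟨κ, M, hκ, _, hreg⟩ := exists_stripRegular_GD (d := d) ha hm
  rw [torusKernelD248_eq_torusKernel n a m2 τ μ (hreg n τ μ) hκ.le N x]
  exact MultiPeriod.torusKernel_descend_eq (hreg n τ μ) hκ hN x

/-- **B4 LEMMA 2.4 (2.35), SECOND QUANTITY, ON THE TORUS — UNIFORMLY IN `j`, THE MASS, THE OFFSET, THE DIRECTION AND THE
VOLUME.**  For `0 < a₋ ≤ a₊`, `m²₊` there are `κ > 0` and `M ≥ 0` such that for EVERY `n = L^j ≥ 1`, `a ∈ [a₋, a₊]`,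
`m² ∈ [0, m²₊]`, `τ`, `μ`, every period vector with all `N_ν ≥ 1` and every `x⁰ ∈ ℤ^{d+1}`:
`‖torusKernelD248 n a m2 τ μ N x⁰‖ ≤ M · periodConst κ d · e^{−(κ/(d+1)) · torusSupNorm N x⁰}`.  ONLY HYPOTHESIS: `0 < a₋`.
[cite: Balaban1983RegularityDecay, Lemma 2.4 (2.35) p.582 (second quantity) with (2.48)–(2.51) pp.585–586 and p.572 (torus);
Balaban1984PropagatorsI p.36 l.20–23; proof supplied by the audit, not printed] -/
theorem dkernel248_torusKernel_decay_torusMetric (d : ℕ) (aminus aplus m2plus : ℝ) (ha : 0 < aminus) :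
    ∃ κ M : ℝ, 0 < κ ∧ 0 ≤ M ∧ ∀ (n : ℕ) [NeZero n] (a m2 : ℝ), aminus ≤ a → a ≤ aplus → 0 ≤ m2 →
      m2 ≤ m2plus → ∀ (τ : Fin (d + 1) → Fin n) (μ : Fin (d + 1)) (N : Fin (d + 1) → ℕ), (∀ i, 1 ≤ N i) →
        ∀ x : Fin (d + 1) → ℤ,
          ‖torusKernelD248 n a m2 τ μ N x‖
            ≤ M * periodConst κ d * Real.exp (-(κ / (d + 1) * MultiPeriod.torusSupNorm N x)) := by
  obtain ⟨κ, M, hκ, hM, h⟩ := derivative248_stripRegular d aminus aplus m2plus ha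
  refine ⟨κ, M, hκ, hM, ?_⟩
  intro n _ a m2 ha1 ha2 hm hmp τ μ N hN x
  have hreg := h n a m2 ha1 ha2 hm hmp τ μ
  rw [torusKernelD248_eq_torusKernel n a m2 τ μ hreg hκ.le N x]
  exact MultiPeriod.torusKernel_descend_decay_torusMetric hreg hκ hN x

/-- the periodisation series of the differentiated lattice kernel obeys the same torus bound (consumer form).
[cite: Balaban1984PropagatorsI, p. 36 l. 20–23; proof supplied by the audit, not printed] -/
theorem dkernel248_periodise_decay (d : ℕ) (aminus aplus m2plus : ℝ) (ha : 0 < aminus) :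
    ∃ κ M : ℝ, 0 < κ ∧ 0 ≤ M ∧ ∀ (n : ℕ) [NeZero n] (a m2 : ℝ), aminus ≤ a → a ≤ aplus → 0 ≤ m2 →
      m2 ≤ m2plus → ∀ (τ : Fin (d + 1) → Fin n) (μ : Fin (d + 1)) (N : Fin (d + 1) → ℕ), (∀ i, 1 ≤ N i) →
        ∀ x : Fin (d + 1) → ℤ,
          ‖∑' m : Fin (d + 1) → ℤ, latticeKernel (GD n a m2 τ μ) (MultiPeriod.translate N x m)‖
            ≤ M * periodConst κ d * Real.exp (-(κ / (d + 1) * MultiPeriod.torusSupNorm N x)) := by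
  obtain ⟨κ, M, hκ, hM, h⟩ := dkernel248_torusKernel_decay_torusMetric d aminus aplus m2plus ha
  refine ⟨κ, M, hκ, hM, ?_⟩
  intro n _ a m2 ha1 ha2 hm hmp τ μ N hN x
  rw [← torusKernelD248_eq_periodise n (lt_of_lt_of_le ha ha1) hm τ μ hN x]
  exact h n a m2 ha1 ha2 hm hmp τ μ N hN x

end Torus

end

end Literature.MathematicalPhysics.QuantumFieldTheory.Balaban1983to89.B4StripSumsDeriv
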